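import Literature.Probability.LatticeModels.TemperleyLiebPercolationHead
import HarnessLib

/-!
# Cap insertion and contraction between planar Temperley–Lieb modules; at loop weight `1` the generator is `e_j = (insert a cap at j) ∘ (contract at j)` and the tower identity is a second difference («TL-CAP-CONTRACT»)

Topic `Literature/Probability/LatticeModels`; a rider on `TemperleyLiebPercolationHead.lean` / `TemperleyLiebLinkModule.lean` (the planar module `LinkPattern (n+2) →₀ R`,
generators `tlL δ j`, the move `connectSucc`, `tlL_one_single`). The monoid move `e_j` on a link diagram «places a cap under the sites `j, j+1` and a cup over them»
(Pearce–Rittenberg–de Gier–Nienhuis 2002, §2 (monoid)); this file separates the two halves as maps BETWEEN link patterns of different sizes: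

* `skip j : Fin n → Fin (n+2)` — the order embedding missing the two sites `j, j+1` (values `i ↦ i` below `j`, `i ↦ i+2` from `j` on), `unskip`, value lemmas;
* `PerfectMatching.capIns j p` — **CAP INSERTION**: the pairing of `n+2` sites pairing `j` with `j+1` and the other sites as `p` does (relabelled by `skip j`);
  `isNonCrossing_capIns` — planar if `p` is; `LinkPattern.capIns`;
* `PerfectMatching.contract j q` (for a pairing `q` of `n+2` sites PAIRING `j` WITH `j+1`) — the pairing of the remaining `n` sites; `isNonCrossing_contract`;
  `LinkPattern.contractSucc j Q := contract j (Q.connectSucc j)` — **CONTRACTION**: connect `j` with `j+1` (a closed loop of weight `1` if they were partners), then delete them;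
* ★★ `LinkPattern.capIns_contractSucc` — `capIns j (contractSucc j Q) = Q.connectSucc j`: **THE MOVE IS CAP ∘ CONTRACTION**; `contractSucc_capIns` — `contractSucc j (capIns j P) = P`;
* `capInsL j`, `contractL j` — the linear maps between the planar modules (`Finsupp.lmapDomain`), ★★ `tlL_one_eq_capInsL_comp_contractL` — **`e_j = capInsL j ∘ contractL j`
  at loop weight `1`**, `contractL_comp_capInsL` (`= id`: the familiar `e_j`-idempotence `e_j² = e_j` at `δ = 1` split in two);
* ★★ `tlL_one_eq_second_difference` — **THE ABSTRACT TOWER IDENTITY**: if `L₁ = L₀ + capInsL j X`, `L₂ = L₁ + capInsL j Y` and `Y = X + contractL j L₀`, then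
  `e_j L₀ = L₂ − 2 L₁ + L₀` — the algebraic skeleton of the lane's hexagon-tower surgery for boundary laws (HOME `FINDING-BSPAN-TOWER-IDENTITY.md`: F1, F2, F1′).

## References
* P. A. Pearce, V. Rittenberg, J. de Gier, B. Nienhuis, *Temperley–Lieb stochastic processes*, J. Phys. A 35 (2002) L661–L668, §2 ((monoid): «placing the graph of the
  generator under the word and erasing the intermediate dashed line»; (TL) `e_j² = (q + q⁻¹) e_j` with `q + q⁻¹ = 1`).
* D. Ridout, Y. Saint-Aubin, *Standard modules, induction and the structure of the Temperley–Lieb algebra*, Adv. Theor. Math. Phys. 18 (2014) = arXiv:1204.4505, §2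
  (link states, the diagram calculus; arXiv pp. 5–8).

## Mathlib / tree
Tree: `TemperleyLiebLinkModule.lean` (`tlL`, `LinkPattern.connectSucc`, `connectSucc_val`), `TemperleyLiebPercolationHead.lean` (`tlL_one_single`,
`LinkPattern.connectSucc_partner_castSucc`), `TemperleyLiebLinkPatterns.lean` (`PerfectMatching`, `connect_partner_left/right`, `partner_partner`, `partner_ne`,
`partner_inj`, `IsNonCrossing`), `TemperleyLiebLinkRelations.lean` (`connect_partner_of_ne`). Mathlib: `Finsupp.lmapDomain`, `Finsupp.mapDomain_single`, `Finsupp.lhom_ext`.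
-/

namespace Literature.Probability.LatticeModels.TemperleyLieb

open Function

/-! ### Skipping two consecutive sites -/

section Skip

variable {n : ℕ}

/-- **the order embedding `Fin n → Fin (n+2)` missing the sites `j, j+1`.** [cite: PearceRittenbergDeGierNienhuis2002, §2 (link diagrams)] -/
def skip (j : Fin (n + 1)) (i : Fin n) : Fin (n + 1 + 1) :=
  if i.val < j.val then ⟨i.val, by omega⟩ else ⟨i.val + 2, by omega⟩

/-- its value. [cite: PearceRittenbergDeGierNienhuis2002, §2] -/
theorem skip_val (j : Fin (n + 1)) (i : Fin n) : (skip j i).val = if i.val < j.val then i.val else i.val + 2 := by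
  unfold skip; split_ifs <;> rfl

/-- `skip j` misses `j`. [cite: PearceRittenbergDeGierNienhuis2002, §2] -/
theorem skip_ne_castSucc (j : Fin (n + 1)) (i : Fin n) : skip j i ≠ Fin.castSucc j := by
  intro e; have := congrArg Fin.val e; rw [skip_val, Fin.val_castSucc] at this; split_ifs at this <;> omega

/-- `skip j` misses `j+1`. [cite: PearceRittenbergDeGierNienhuis2002, §2] -/
theorem skip_ne_succ (j : Fin (n + 1)) (i : Fin n) : skip j i ≠ j.succ := by
  intro e; have := congrArg Fin.val e; rw [skip_val, Fin.val_succ] at this; split_ifs at this <;> omega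

/-- `skip j` is strictly monotone. [cite: PearceRittenbergDeGierNienhuis2002, §2] -/
theorem skip_lt_iff (j : Fin (n + 1)) {i i' : Fin n} : skip j i < skip j i' ↔ i < i' := by
  rw [Fin.lt_def, Fin.lt_def, skip_val, skip_val]; split_ifs <;> omega

/-- `skip j` is injective. [cite: PearceRittenbergDeGierNienhuis2002, §2] -/
theorem skip_injective (j : Fin (n + 1)) : Injective (skip j) := by
  intro i i' e; apply Fin.ext; have := congrArg Fin.val e; rw [skip_val, skip_val] at this; split_ifs at this <;> omega

/-- **the partial inverse**: a site other than `j, j+1` comes from `Fin n`. [cite: PearceRittenbergDeGierNienhuis2002, §2] -/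
def unskip (j : Fin (n + 1)) (x : Fin (n + 1 + 1)) (h1 : x ≠ Fin.castSucc j) (h2 : x ≠ j.succ) : Fin n :=
  if h : x.val < j.val then ⟨x.val, by omega⟩ else ⟨x.val - 2, by
    have e1 : x.val ≠ j.val := fun e => h1 (Fin.ext (by rw [Fin.val_castSucc]; exact e))
    have e2 : x.val ≠ j.val + 1 := fun e => h2 (Fin.ext (by rw [Fin.val_succ]; exact e))
    omega⟩

/-- its value. [cite: PearceRittenbergDeGierNienhuis2002, §2] -/
theorem unskip_val (j : Fin (n + 1)) (x : Fin (n + 1 + 1)) (h1 : x ≠ Fin.castSucc j) (h2 : x ≠ j.succ) :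
    (unskip j x h1 h2).val = if x.val < j.val then x.val else x.val - 2 := by
  unfold unskip; split_ifs <;> rfl

/-- `skip ∘ unskip = id` off `j, j+1`. [cite: PearceRittenbergDeGierNienhuis2002, §2] -/
theorem skip_unskip (j : Fin (n + 1)) (x : Fin (n + 1 + 1)) (h1 : x ≠ Fin.castSucc j) (h2 : x ≠ j.succ) : skip j (unskip j x h1 h2) = x := by
  apply Fin.ext
  have e1 : x.val ≠ j.val := fun e => h1 (Fin.ext (by rw [Fin.val_castSucc]; exact e))
  have e2 : x.val ≠ j.val + 1 := fun e => h2 (Fin.ext (by rw [Fin.val_succ]; exact e))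
  rw [skip_val, unskip_val]
  split_ifs <;> omega

/-- `unskip ∘ skip = id`. [cite: PearceRittenbergDeGierNienhuis2002, §2] -/
theorem unskip_skip (j : Fin (n + 1)) (i : Fin n) : unskip j (skip j i) (skip_ne_castSucc j i) (skip_ne_succ j i) = i := by
  apply Fin.ext
  rw [unskip_val, skip_val]
  split_ifs <;> omega

end Skip

/-! ### Cap insertion -/

namespace PerfectMatching

variable {n : ℕ}

/-- the partner function of the cap insertion. [cite: PearceRittenbergDeGierNienhuis2002, §2 (monoid: the cup–cap)] -/
def capInsPartner (j : Fin (n + 1)) (p : PerfectMatching n) (x : Fin (n + 1 + 1)) : Fin (n + 1 + 1) :=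
  if h1 : x = Fin.castSucc j then j.succ else if h2 : x = j.succ then Fin.castSucc j else skip j (p.partner (unskip j x h1 h2))

/-- **CAP INSERTION**: pair `j` with `j+1` and the other `n` sites as `p` does. [cite: PearceRittenbergDeGierNienhuis2002, §2 (monoid: the cup–cap)] -/
def capIns (j : Fin (n + 1)) (p : PerfectMatching n) : PerfectMatching (n + 1 + 1) where
  partner := capInsPartner j p
  partner_partner x := by
    unfold capInsPartner
    have hcs : Fin.castSucc j ≠ j.succ := (show Fin.castSucc j < j.succ from Fin.castSucc_lt_succ).ne
    by_cases h1 : x = Fin.castSucc j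
    · subst h1; rw [dif_pos rfl, dif_neg hcs.symm, dif_pos rfl]
    by_cases h2 : x = j.succ
    · subst h2; rw [dif_neg hcs.symm, dif_pos rfl, dif_pos rfl]
    rw [dif_neg h1, dif_neg h2, dif_neg (skip_ne_castSucc j _), dif_neg (skip_ne_succ j _), unskip_skip, p.partner_partner, skip_unskip]
  partner_ne x := by
    unfold capInsPartner
    have hcs : Fin.castSucc j ≠ j.succ := (show Fin.castSucc j < j.succ from Fin.castSucc_lt_succ).ne
    by_cases h1 : x = Fin.castSucc j
    · subst h1; rw [dif_pos rfl]; exact hcs.symm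
    by_cases h2 : x = j.succ
    · subst h2; rw [dif_neg hcs.symm, dif_pos rfl]; exact hcs
    rw [dif_neg h1, dif_neg h2]
    intro e
    have e' : skip j (p.partner (unskip j x h1 h2)) = skip j (unskip j x h1 h2) := by rw [e, skip_unskip]
    exact p.partner_ne _ (skip_injective j e')

/-- the cap: `j ↦ j+1`. [cite: PearceRittenbergDeGierNienhuis2002, §2 (monoid)] -/
theorem capIns_partner_castSucc (j : Fin (n + 1)) (p : PerfectMatching n) : (capIns j p).partner (Fin.castSucc j) = j.succ := by
  show capInsPartner j p _ = _; unfold capInsPartner; rw [dif_pos rfl]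

/-- the cap: `j+1 ↦ j`. [cite: PearceRittenbergDeGierNienhuis2002, §2 (monoid)] -/
theorem capIns_partner_succ (j : Fin (n + 1)) (p : PerfectMatching n) : (capIns j p).partner j.succ = Fin.castSucc j := by
  show capInsPartner j p _ = _; unfold capInsPartner
  have hcs : Fin.castSucc j ≠ j.succ := (show Fin.castSucc j < j.succ from Fin.castSucc_lt_succ).ne
  rw [dif_neg hcs.symm, dif_pos rfl]

/-- the other sites: as `p`, relabelled. [cite: PearceRittenbergDeGierNienhuis2002, §2 (monoid)] -/
theorem capIns_partner_skip (j : Fin (n + 1)) (p : PerfectMatching n) (i : Fin n) : (capIns j p).partner (skip j i) = skip j (p.partner i) := by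
  show capInsPartner j p _ = _; unfold capInsPartner
  rw [dif_neg (skip_ne_castSucc j i), dif_neg (skip_ne_succ j i), unskip_skip]

/-- ★ **cap insertion preserves planarity** (the new chord joins neighbours; the old chords are moved by an order embedding).
[cite: PearceRittenbergDeGierNienhuis2002, §2 (non-intersecting half-loops)] -/
theorem isNonCrossing_capIns (j : Fin (n + 1)) {p : PerfectMatching n} (hp : IsNonCrossing p) : IsNonCrossing (capIns j p) := by
  intro a b hab h1 h2
  have hcs : Fin.castSucc j < j.succ := Fin.castSucc_lt_succ
  -- `a` is not `j` (its chord would be `{j, j+1}` with nothing strictly inside) nor `j+1` (then `a > partner a`)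
  by_cases ha1 : a = Fin.castSucc j
  · subst ha1
    rw [capIns_partner_castSucc] at hab h2
    exfalso; rw [Fin.lt_def, Fin.val_castSucc] at h1; rw [Fin.lt_def, Fin.val_succ] at h2; omega
  by_cases ha2 : a = j.succ
  · subst ha2; rw [capIns_partner_succ] at hab; exact absurd hab (not_lt.2 hcs.le)
  -- so `a = skip i`
  obtain ⟨i, rfl⟩ : ∃ i, skip j i = a := ⟨unskip j a ha1 ha2, skip_unskip j a ha1 ha2⟩
  rw [capIns_partner_skip] at hab h2 ⊢
  have hi : i < p.partner i := (skip_lt_iff j).1 hab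
  by_cases hb1 : b = Fin.castSucc j
  · subst hb1
    rw [capIns_partner_castSucc]
    -- `j` strictly inside the chord `skip i < j < skip (p i)` forces `j+1` inside too (`skip` jumps over both)
    refine ⟨lt_trans h1 hcs, ?_⟩
    rw [Fin.lt_def, skip_val, Fin.val_castSucc] at h1 h2
    rw [Fin.lt_def, skip_val, Fin.val_succ]
    split_ifs at h1 h2 ⊢ <;> omega
  by_cases hb2 : b = j.succ
  · subst hb2
    rw [capIns_partner_succ]
    refine ⟨?_, lt_trans hcs h2⟩
    rw [Fin.lt_def, skip_val, Fin.val_succ] at h1 h2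
    rw [Fin.lt_def, skip_val, Fin.val_castSucc]
    split_ifs at h1 h2 ⊢ <;> omega
  obtain ⟨i', rfl⟩ : ∃ i', skip j i' = b := ⟨unskip j b hb1 hb2, skip_unskip j b hb1 hb2⟩
  rw [capIns_partner_skip, skip_lt_iff, skip_lt_iff]
  exact hp i i' hi ((skip_lt_iff j).1 h1) ((skip_lt_iff j).1 h2)

end PerfectMatching

/-- **cap insertion on link patterns.** [cite: PearceRittenbergDeGierNienhuis2002, §2 (monoid: the cup–cap)] -/
def LinkPattern.capIns {n : ℕ} (j : Fin (n + 1)) (P : LinkPattern n) : LinkPattern (n + 1 + 1) :=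
  ⟨PerfectMatching.capIns j P.1, PerfectMatching.isNonCrossing_capIns j P.2⟩

/-! ### Contraction -/

namespace PerfectMatching

variable {n : ℕ}

/-- in a pairing pairing `j` with `j+1`, the other sites are paired among themselves. [cite: PearceRittenbergDeGierNienhuis2002, §2] -/
theorem partner_ne_castSucc_of_pair (j : Fin (n + 1)) {q : PerfectMatching (n + 1 + 1)} (hq : q.partner (Fin.castSucc j) = j.succ) {x : Fin (n + 1 + 1)}
    (h2 : x ≠ j.succ) : q.partner x ≠ Fin.castSucc j := by
  intro e
  have : x = j.succ := by rw [← hq, ← e, q.partner_partner]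
  exact h2 this

/-- … (the other end of the cap). [cite: PearceRittenbergDeGierNienhuis2002, §2] -/
theorem partner_ne_succ_of_pair (j : Fin (n + 1)) {q : PerfectMatching (n + 1 + 1)} (hq : q.partner (Fin.castSucc j) = j.succ) {x : Fin (n + 1 + 1)}
    (h1 : x ≠ Fin.castSucc j) : q.partner x ≠ j.succ := by
  intro e
  have hq' : q.partner j.succ = Fin.castSucc j := by rw [← hq, q.partner_partner]
  have : x = Fin.castSucc j := by rw [← hq', ← e, q.partner_partner]
  exact h1 this

/-- **CONTRACTION of a pairing that pairs `j` with `j+1`**: delete the two sites. [cite: PearceRittenbergDeGierNienhuis2002, §2 (monoid: erase the closed arc)] -/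
def contract (j : Fin (n + 1)) (q : PerfectMatching (n + 1 + 1)) (hq : q.partner (Fin.castSucc j) = j.succ) : PerfectMatching n where
  partner i := unskip j (q.partner (skip j i)) (partner_ne_castSucc_of_pair j hq (skip_ne_succ j i))
    (partner_ne_succ_of_pair j hq (skip_ne_castSucc j i))
  partner_partner i := by
    apply skip_injective j
    rw [skip_unskip, skip_unskip, q.partner_partner]
  partner_ne i := by
    intro e
    have e' := congrArg (skip j) e
    rw [skip_unskip] at e'
    exact q.partner_ne _ e'

/-- the contraction, relabelled back: `skip (contract q i) = q (skip i)`. [cite: PearceRittenbergDeGierNienhuis2002, §2] -/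
theorem skip_contract_partner (j : Fin (n + 1)) (q : PerfectMatching (n + 1 + 1)) (hq : q.partner (Fin.castSucc j) = j.succ) (i : Fin n) :
    skip j ((contract j q hq).partner i) = q.partner (skip j i) :=
  skip_unskip j (q.partner (skip j i)) (partner_ne_castSucc_of_pair j hq (skip_ne_succ j i)) (partner_ne_succ_of_pair j hq (skip_ne_castSucc j i))

/-- contractions of equal pairings agree (the proof argument is irrelevant). [cite: PearceRittenbergDeGierNienhuis2002, §2] -/
theorem contract_congr (j : Fin (n + 1)) {q q' : PerfectMatching (n + 1 + 1)} (e : q = q') (hq : q.partner (Fin.castSucc j) = j.succ)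
    (hq' : q'.partner (Fin.castSucc j) = j.succ) : contract j q hq = contract j q' hq' := by
  subst e; rfl

/-- ★ **contraction preserves planarity.** [cite: PearceRittenbergDeGierNienhuis2002, §2 (non-intersecting half-loops)] -/
theorem isNonCrossing_contract (j : Fin (n + 1)) {q : PerfectMatching (n + 1 + 1)} (hq : q.partner (Fin.castSucc j) = j.succ) (hnc : IsNonCrossing q) :
    IsNonCrossing (contract j q hq) := by
  intro a b hab h1 h2
  have hab' : skip j a < q.partner (skip j a) := by rw [← skip_contract_partner j q hq]; exact (skip_lt_iff j).2 hab
  have h2' : skip j b < q.partner (skip j a) := by rw [← skip_contract_partner j q hq]; exact (skip_lt_iff j).2 h2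
  obtain ⟨k1, k2⟩ := hnc (skip j a) (skip j b) hab' ((skip_lt_iff j).2 h1) h2'
  have e1 : q.partner (skip j a) = skip j ((contract j q hq).partner a) := (skip_contract_partner j q hq a).symm
  have e2 : q.partner (skip j b) = skip j ((contract j q hq).partner b) := (skip_contract_partner j q hq b).symm
  rw [e2] at k1
  rw [e2, e1] at k2
  exact ⟨(skip_lt_iff j).1 k1, (skip_lt_iff j).1 k2⟩

/-- ★ **cap after contraction gives back the pairing** (which pairs `j` with `j+1`). [cite: PearceRittenbergDeGierNienhuis2002, §2 (monoid)] -/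
theorem capIns_contract (j : Fin (n + 1)) (q : PerfectMatching (n + 1 + 1)) (hq : q.partner (Fin.castSucc j) = j.succ) : capIns j (contract j q hq) = q := by
  apply PerfectMatching.ext
  funext x
  by_cases h1 : x = Fin.castSucc j
  · subst h1; rw [capIns_partner_castSucc, hq]
  by_cases h2 : x = j.succ
  · subst h2; rw [capIns_partner_succ, ← hq, q.partner_partner]
  obtain ⟨i, rfl⟩ : ∃ i, skip j i = x := ⟨unskip j x h1 h2, skip_unskip j x h1 h2⟩
  rw [capIns_partner_skip, skip_contract_partner]

/-- ★ **contraction after cap insertion gives back the pairing.** [cite: PearceRittenbergDeGierNienhuis2002, §2 (monoid)] -/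
theorem contract_capIns (j : Fin (n + 1)) (p : PerfectMatching n) : contract j (capIns j p) (capIns_partner_castSucc j p) = p := by
  apply PerfectMatching.ext
  funext i
  apply skip_injective j
  rw [skip_contract_partner, capIns_partner_skip]

end PerfectMatching

namespace LinkPattern

variable {n : ℕ}

/-- **CONTRACTION AT `j` on link patterns**: connect `j` with `j+1` (a loop of weight `1` if already partners), then delete the two sites.
[cite: PearceRittenbergDeGierNienhuis2002, §2 (monoid: erase the intermediate line and the closed loops)] -/
noncomputable def contractSucc (j : Fin (n + 1)) (Q : LinkPattern (n + 1 + 1)) : LinkPattern n :=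
  ⟨PerfectMatching.contract j (Q.connectSucc j).1 (Q.connectSucc_partner_castSucc j),
    PerfectMatching.isNonCrossing_contract j (Q.connectSucc_partner_castSucc j) (Q.connectSucc j).2⟩

/-- ★★ **THE MOVE IS CAP ∘ CONTRACTION**: `capIns j (contractSucc j Q) = Q · e_j`. [cite: PearceRittenbergDeGierNienhuis2002, §2 (monoid)] -/
theorem capIns_contractSucc (j : Fin (n + 1)) (Q : LinkPattern (n + 1 + 1)) : capIns j (contractSucc j Q) = Q.connectSucc j :=
  Subtype.ext (PerfectMatching.capIns_contract j (Q.connectSucc j).1 (Q.connectSucc_partner_castSucc j))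

/-- ★ **contracting a freshly inserted cap gives back the pattern.** [cite: PearceRittenbergDeGierNienhuis2002, §2 (monoid)] -/
theorem contractSucc_capIns (j : Fin (n + 1)) (P : LinkPattern n) : contractSucc j (capIns j P) = P := by
  have h : (capIns j P).connectSucc j = capIns j P := connectSucc_of_partner_eq _ (PerfectMatching.capIns_partner_castSucc j P.1)
  apply Subtype.ext
  show PerfectMatching.contract j ((capIns j P).connectSucc j).1 ((capIns j P).connectSucc_partner_castSucc j) = P.1
  rw [PerfectMatching.contract_congr j (congrArg Subtype.val h) ((capIns j P).connectSucc_partner_castSucc j)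
    (PerfectMatching.capIns_partner_castSucc j P.1)]
  exact PerfectMatching.contract_capIns j P.1

end LinkPattern

/-! ### The linear maps and the factorisation of the generator at loop weight `1` -/

section Linear

variable (R : Type*) [CommRing R] {n : ℕ}

/-- **cap insertion as a linear map between the planar modules** `V_n → V_{n+2}`. [cite: PearceRittenbergDeGierNienhuis2002, §2 (monoid)] -/
noncomputable def capInsL (j : Fin (n + 1)) : (LinkPattern n →₀ R) →ₗ[R] (LinkPattern (n + 1 + 1) →₀ R) :=
  Finsupp.lmapDomain R R (LinkPattern.capIns j)

/-- **contraction as a linear map** `V_{n+2} → V_n` (loop weight `1`). [cite: PearceRittenbergDeGierNienhuis2002, §2 (monoid)] -/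
noncomputable def contractL (j : Fin (n + 1)) : (LinkPattern (n + 1 + 1) →₀ R) →ₗ[R] (LinkPattern n →₀ R) :=
  Finsupp.lmapDomain R R (LinkPattern.contractSucc j)

variable {R}

/-- on basis vectors. [cite: PearceRittenbergDeGierNienhuis2002, §2] -/
theorem capInsL_single (j : Fin (n + 1)) (P : LinkPattern n) (c : R) : capInsL R j (Finsupp.single P c) = Finsupp.single (P.capIns j) c := by
  rw [capInsL, Finsupp.lmapDomain_apply, Finsupp.mapDomain_single]

/-- on basis vectors. [cite: PearceRittenbergDeGierNienhuis2002, §2] -/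
theorem contractL_single (j : Fin (n + 1)) (Q : LinkPattern (n + 1 + 1)) (c : R) : contractL R j (Finsupp.single Q c) = Finsupp.single (Q.contractSucc j) c := by
  rw [contractL, Finsupp.lmapDomain_apply, Finsupp.mapDomain_single]

/-- ★★ **AT LOOP WEIGHT `1` THE GENERATOR FACTORS AS CAP ∘ CONTRACTION**: `e_j = capInsL j ∘ contractL j`. [cite: PearceRittenbergDeGierNienhuis2002, §2 ((monoid), `q + q⁻¹ = 1`)] -/
theorem tlL_one_eq_capInsL_comp_contractL (j : Fin (n + 1)) : tlL R (1 : R) j = capInsL R j ∘ₗ contractL R j := by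
  refine Finsupp.lhom_ext fun Q c => ?_
  rw [LinearMap.comp_apply, contractL_single, capInsL_single, tlL_one_single, LinkPattern.capIns_contractSucc]

/-- ★ **contraction ∘ cap = identity** (so `e_j² = e_j` at `δ = 1` in two halves). [cite: PearceRittenbergDeGierNienhuis2002, §2 ((TL): `e_j² = (q + q⁻¹) e_j`)] -/
theorem contractL_comp_capInsL (j : Fin (n + 1)) : contractL R j ∘ₗ capInsL R j = LinearMap.id := by
  refine Finsupp.lhom_ext fun P c => ?_
  rw [LinearMap.comp_apply, capInsL_single, contractL_single, LinkPattern.contractSucc_capIns, LinearMap.id_apply]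

/-- ★★ **THE ABSTRACT TOWER IDENTITY**: if `L₁ = L₀ + cap(X)`, `L₂ = L₁ + cap(Y)` and `Y = X + contract(L₀)`, then `e_j L₀ = L₂ − 2 L₁ + L₀` — the algebraic skeleton of the
lane's hexagon-tower surgery for percolation boundary laws (F1, F2, F1′ of HOME `FINDING-BSPAN-TOWER-IDENTITY.md`). [cite: PearceRittenbergDeGierNienhuis2002, §2 (monoid)] -/
theorem tlL_one_eq_second_difference (j : Fin (n + 1)) {L₀ L₁ L₂ : LinkPattern (n + 1 + 1) →₀ R} {X Y : LinkPattern n →₀ R}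
    (h₁ : L₁ = L₀ + capInsL R j X) (h₂ : L₂ = L₁ + capInsL R j Y) (hY : Y = X + contractL R j L₀) :
    tlL R (1 : R) j L₀ = L₂ - 2 • L₁ + L₀ := by
  rw [tlL_one_eq_capInsL_comp_contractL, LinearMap.comp_apply, h₂, h₁, hY, map_add, two_smul]
  abel

end Linear

end Literature.Probability.LatticeModels.TemperleyLieb
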